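import Summits.CriticalPhenomena.Ising3DConformalLimit.Theorems.PrecisionLaplacianDirectCorrelationStableTailPickInversionAux4

/-!
# Pick inversion, auxiliary file 5: boundary values of the Nevanlinna representation and the
# representation of `-1/F` on the half-line `(-∞, 1)`

Helper file for stub `stub_pickInversion` of line `self-energy-pick-inversion`, crux
`PrecisionLaplacian.DirectCorrelationStableTail` (stmt-CriticalPhenomena-4799). Pure theorem file.

* `nevanlinna_repr_of_real_lt_one` : if `H` is continuous on the slit region, has the Nevanlinna
  representation on the upper half-plane and its measure does not charge `(-∞, 1)`, then the
  representation holds at every real `x < 1` (dominated convergence as `z = x + iε → x`, with the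
  bound `|1/(s - z) - s/(1 + s²)| ≤ C_x/(1 + s²)` for `s ≥ 1`).
* `exists_nevanlinna_repr_neg_inv_poissonTransform` (registered sub-goal
  `stub_pickInversion_auxNevanlinna`): for a finite positive measure `μ` on `[0, 1]` charging
  `[0, 1)`, there are `b ∈ ℝ`, `β ≥ 0` and a positive measure `ρ` on `[1, ∞)` with
  `∫ dρ/(1 + s²) < ∞` such that for every real `x < 1`,
  `-1/∫ (1 - t²)/(1 - 2tx + t²) dμ(t) = b + βx + π⁻¹ ∫ (1/(s - x) - s/(1 + s²)) dρ(s)`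
  (tree: `Literature.Analysis.Complex.nevanlinna_representation_holds`, plus files 3–4).

References: Rosenblum–Rovnyak (1985), App. §6; Donoghue (1974), Ch. II.
-/

noncomputable section

namespace Summit.CriticalPhenomena.Ising3DConformalLimit.Cruxes.DirectCorrelationStableTail.SelfEnergyPickInversion

open MeasureTheory Filter Topology Set Real Complex Metric
open scoped BigOperators ComplexConjugate
open Literature.Analysis.Complex

/-! ### A bound for the Nevanlinna kernel near the real axis below `1` -/

/-! ### Boundary values of the Nevanlinna representation on `(-∞, 1)` -/

/-- **The Nevanlinna representation extends to the half-line `(-∞, 1)`** when the measure lives on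
`[1, ∞)`: if `H` is continuous on the slit region `{Im z > 0} ∪ {Re z < 1}`, represented on the
upper half-plane by `b + βz + π⁻¹ ∫ (1/(s - z) - s/(1 + s²)) dρ(s)` with `ρ((-∞,1)) = 0`, then the
same formula holds at every real `x < 1`. [folklore] -/
theorem nevanlinna_repr_of_real_lt_one {H : ℂ → ℂ} {b β : ℝ} {ρ : Measure ℝ}
    (hcont : ContinuousOn H {z : ℂ | 0 < z.im ∨ z.re < 1})
    (hρ : Integrable (fun s : ℝ => (1 + s ^ 2)⁻¹) ρ) (hρ1 : ρ (Set.Iio 1) = 0)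
    (hrep : ∀ z ∈ UpperHalfPlane.upperHalfPlaneSet, H z = (b : ℂ) + (β : ℂ) * z +
      (Real.pi : ℂ)⁻¹ * ∫ s : ℝ, (((s : ℂ) - z)⁻¹ - (s : ℂ) / (1 + (s : ℂ) ^ 2)) ∂ρ)
    {x : ℝ} (hx : x < 1) :
    H x = (b : ℂ) + (β : ℂ) * x +
      (Real.pi : ℂ)⁻¹ * ∫ s : ℝ, (((s : ℂ) - x)⁻¹ - (s : ℂ) / (1 + (s : ℂ) ^ 2)) ∂ρ := by
  have hae : ∀ᵐ s ∂ρ, 1 ≤ s := by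
    rw [ae_iff]
    simp only [not_le]
    exact hρ1
  have hxU : (x : ℂ) ∈ {z : ℂ | 0 < z.im ∨ z.re < 1} := Or.inr (by simpa using hx)
  -- the path `ε ↦ x + iε`
  have hpath : Tendsto (fun ε : ℝ => (x : ℂ) + ε * I) (𝓝[>] 0) (𝓝 (x : ℂ)) := by
    have : Continuous fun ε : ℝ => (x : ℂ) + ε * I := by fun_prop
    simpa using (this.tendsto 0).mono_left nhdsWithin_le_nhds
  have hev : ∀ᶠ ε in 𝓝[>] (0 : ℝ), ε ∈ Set.Ioo 0 1 := Ioo_mem_nhdsGT zero_lt_one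
  -- left-hand side
  have hL : Tendsto (fun ε : ℝ => H ((x : ℂ) + ε * I)) (𝓝[>] 0) (𝓝 (H x)) :=
    (hcont.continuousAt (isOpen_slitRegion.mem_nhds hxU)).tendsto.comp hpath
  -- the integral term
  have hI : Tendsto (fun ε : ℝ => ∫ s : ℝ, (((s : ℂ) - ((x : ℂ) + ε * I))⁻¹ - (s : ℂ) / (1 + (s : ℂ) ^ 2)) ∂ρ)
      (𝓝[>] 0) (𝓝 (∫ s : ℝ, (((s : ℂ) - x)⁻¹ - (s : ℂ) / (1 + (s : ℂ) ^ 2)) ∂ρ)) := by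
    set C : ℝ := (1 + (|x| + 1) ^ 2) / (1 - x) + (|x| + 1) with hC
    refine tendsto_integral_filter_of_dominated_convergence (fun s => C * (1 + s ^ 2)⁻¹) ?_ ?_
      (hρ.const_mul C) ?_
    · filter_upwards [hev] with ε hε
      have hz : 0 < ((x : ℂ) + ε * I).im := by simpa using hε.1
      exact (integrable_nevanlinna_kernel hρ hz).aestronglyMeasurable
    · filter_upwards [hev] with ε hε
      filter_upwards [hae] with s hs
      exact norm_nevanlinna_kernel_le_of_re_lt hx hs (by simp) (by simp [abs_of_pos hε.1, hε.2.le])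
    · filter_upwards [hae] with s hs
      have hsx : (s : ℂ) - x ≠ 0 := by
        intro h; have := congrArg Complex.re h; simp at this; linarith
      have hk : ContinuousAt (fun z : ℂ => ((s : ℂ) - z)⁻¹ - (s : ℂ) / (1 + (s : ℂ) ^ 2)) (x : ℂ) :=
        ContinuousAt.sub (ContinuousAt.inv₀ (by fun_prop) hsx) continuousAt_const
      exact hk.tendsto.comp hpath
  have hR : Tendsto (fun ε : ℝ => (b : ℂ) + (β : ℂ) * ((x : ℂ) + ε * I) +
      (Real.pi : ℂ)⁻¹ * ∫ s : ℝ, (((s : ℂ) - ((x : ℂ) + ε * I))⁻¹ - (s : ℂ) / (1 + (s : ℂ) ^ 2)) ∂ρ)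
      (𝓝[>] 0) (𝓝 ((b : ℂ) + (β : ℂ) * x +
        (Real.pi : ℂ)⁻¹ * ∫ s : ℝ, (((s : ℂ) - x)⁻¹ - (s : ℂ) / (1 + (s : ℂ) ^ 2)) ∂ρ)) :=
    (tendsto_const_nhds.add (tendsto_const_nhds.mul hpath)).add (tendsto_const_nhds.mul hI)
  -- the two sides agree for `ε > 0`
  have heq : (fun ε : ℝ => H ((x : ℂ) + ε * I)) =ᶠ[𝓝[>] 0] fun ε : ℝ => (b : ℂ) + (β : ℂ) * ((x : ℂ) + ε * I) +
      (Real.pi : ℂ)⁻¹ * ∫ s : ℝ, (((s : ℂ) - ((x : ℂ) + ε * I))⁻¹ - (s : ℂ) / (1 + (s : ℂ) ^ 2)) ∂ρ := by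
    filter_upwards [hev] with ε hε
    exact hrep _ (show 0 < ((x : ℂ) + ε * I).im by simpa using hε.1)
  exact tendsto_nhds_unique (hL.congr' heq) hR

/-! ### The representation of `-1/F` on `(-∞, 1)` for the Poisson transform `F` -/

/-- **Nevanlinna data of `-1/F`.** For a finite positive measure `μ` on `[0, 1]` charging `[0, 1)`
and `F(z) = ∫ (1 - t²)/(1 - 2tz + t²) dμ(t)`: there are `b ∈ ℝ`, `β ≥ 0` and a positive measure
`ρ` with `∫ dρ/(1 + s²) < ∞` and `ρ((-∞, 1)) = 0` such that for all real `x < 1`,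
`-1/F(x) = b + βx + π⁻¹ ∫ (1/(s - x) - s/(1 + s²)) dρ(s)`. [folklore] -/
theorem exists_nevanlinna_repr_neg_inv_poissonTransform (μ : Measure ℝ) [IsFiniteMeasure μ]
    (hμ : μ (Set.Icc (0 : ℝ) 1)ᶜ = 0) (hμ0 : μ (Set.Ico (0 : ℝ) 1) ≠ 0) :
    ∃ (b β : ℝ) (ρ : Measure ℝ), 0 ≤ β ∧ Integrable (fun s : ℝ => (1 + s ^ 2)⁻¹) ρ ∧
      ρ (Set.Iio 1) = 0 ∧ ∀ x : ℝ, x < 1 →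
        -(∫ t, (1 - t ^ 2) / (1 - 2 * t * x + t ^ 2) ∂μ)⁻¹ =
          b + β * x + π⁻¹ * ∫ s, ((s - x)⁻¹ - s / (1 + s ^ 2)) ∂ρ := by
  set H : ℂ → ℂ := fun z => -(∫ t, ((1 - t ^ 2 : ℝ) : ℂ) / (1 - 2 * (t : ℂ) * z + (t : ℂ) ^ 2) ∂μ)⁻¹
    with hH
  have hPick : IsPickFunction H := isPickFunction_neg_inv_poissonTransform μ hμ hμ0
  obtain ⟨b, β, ρ, hβ, hρ, hrep⟩ := (nevanlinna_representation_holds H).1 hPick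
  have hcont : ContinuousOn H {z : ℂ | 0 < z.im ∨ z.re < 1} :=
    (((differentiableOn_poissonTransform μ hμ).inv fun z hz =>
      poissonTransform_ne_zero μ hμ hμ0 hz).neg).continuousOn
  have hHreal : ∀ x : ℝ, H x = ((-(∫ t, (1 - t ^ 2) / (1 - 2 * t * x + t ^ 2) ∂μ)⁻¹ : ℝ) : ℂ) := by
    intro x
    simp only [hH, poissonTransform_ofReal]
    push_cast
    rfl
  have hreal : ∀ x : ℝ, x < 1 → (H x).im = 0 := fun x _ => by rw [hHreal, Complex.ofReal_im]
  have hρ1 : ρ (Set.Iio 1) = 0 := nevanlinna_measure_Iio_eq_zero hcont hreal hβ hρ hrep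
  refine ⟨b, β, ρ, hβ, hρ, hρ1, fun x hx => ?_⟩
  have h := nevanlinna_repr_of_real_lt_one hcont hρ hρ1 hrep hx
  rw [hHreal] at h
  have hK : (fun s : ℝ => ((s : ℂ) - x)⁻¹ - (s : ℂ) / (1 + (s : ℂ) ^ 2)) =
      fun s : ℝ => (((s - x)⁻¹ - s / (1 + s ^ 2) : ℝ) : ℂ) := by
    funext s; push_cast; rfl
  have hint : ∫ s, (((s - x)⁻¹ - s / (1 + s ^ 2) : ℝ) : ℂ) ∂ρ =
      ((∫ s, ((s - x)⁻¹ - s / (1 + s ^ 2)) ∂ρ : ℝ) : ℂ) := _root_.integral_ofReal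
  rw [hK, hint] at h
  have hpi : ((Real.pi : ℂ)⁻¹) = ((Real.pi⁻¹ : ℝ) : ℂ) := by push_cast; rfl
  rw [hpi] at h
  exact_mod_cast h

/-- **Registered auxiliary stub `stub_pickInversion_auxNevanlinna`** (sub-goal of
`stub_pickInversion`): the Nevanlinna representation of `-1/F` on `(-∞, 1)` for the Poisson
transform `F` of a finite positive measure on `[0, 1]` charging `[0, 1)`, with representing measure
carried by `[1, ∞)` (`exists_nevanlinna_repr_neg_inv_poissonTransform`). [folklore] -/
theorem stub_pickInversion_auxNevanlinna : ∀ (μ : MeasureTheory.Measure ℝ), MeasureTheory.IsFiniteMeasure μ →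
    μ (Set.Icc (0 : ℝ) 1)ᶜ = 0 → μ (Set.Ico (0 : ℝ) 1) ≠ 0 →
    ∃ (b β : ℝ) (ρ : MeasureTheory.Measure ℝ), 0 ≤ β ∧
      MeasureTheory.Integrable (fun s : ℝ => (1 + s ^ 2)⁻¹) ρ ∧ ρ (Set.Iio 1) = 0 ∧
      ∀ x : ℝ, x < 1 → -(∫ t, (1 - t ^ 2) / (1 - 2 * t * x + t ^ 2) ∂μ)⁻¹ =
        b + β * x + Real.pi⁻¹ * ∫ s, ((s - x)⁻¹ - s / (1 + s ^ 2)) ∂ρ :=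
  fun μ hfin hμ hμ0 => by
    haveI := hfin
    exact exists_nevanlinna_repr_neg_inv_poissonTransform μ hμ hμ0

end Summit.CriticalPhenomena.Ising3DConformalLimit.Cruxes.DirectCorrelationStableTail.SelfEnergyPickInversion

end
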